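import Summits.QuantumFields.YangMills.Theorems.BalabanUVNodesN15KingModelDressedJetNoFit
import Summits.QuantumFields.YangMills.Theorems.BalabanUVNodesN15TwoGridFirstOrderSupCarrier
import HarnessLib

/-!
# N15 (NE2) — PROGRAMME K, part K-C: ★★★ `T4EtaRate.NE2PlusOperator` BY NAME, HYPOTHESIS-FREE, FOR KING's FULL `A = 0` PROPAGATOR `⊗ 1` DRESSED BY THE FIRST-ORDER SPECIES ON THE (3.35)-PAIR
# CARRIER `coeffBgFO` — ENTRIES 0 (VALUE) AND 1 (THE DRESSED GRADIENT) BACKGROUND-LIVE, NO LETTER ON `∇c′`, NO FIT OF `c′` (dag-n15-d g20 «KNIT (go)», INBOX l.42374)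

WHO ∕ WHEN.  Cell `pub-ymgap`, seat `pub-ymgap-dag-n15-a` (KNIT-BY-NAME seat of Track-A DAG node N15 = NE2, g25); `--kind proof --supports stmt-QuantumFields-27366 --as helper` (K3⁸;
count-neutral).  Plumbing `def`s (§5: the realised instance ∕ family over an index) + theorems.  Over K-B `…KingModelDressedJetNoFit` (★★ `hasMaj_projO_idef_bgPair_kingJet`), K-A
`…KingModelJetLettersColour` (`hasMaj_idef_tensorId_kingSOp`, `hasMaj_idef_tensorId_kingLapOp`), II-E `…TwoGridFirstOrderSupCarrier` (`coeffBgFO`, `reg335_coeffBgFO_iff`, `foPairing`, `foOps`,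
`abs_bquot_le_of_fgrad`, `osc_rate_le`), dag-n15-e Σ `EtaLatIdx` (`…KingModelFullPropagatorNE2Operator`), n15-b (`fineGeo`, `one_le_pref4`, `projO`, `bgPair`), n15-c FILE 10 (`fibreOsc_of_fgrad`), g0
`OperatorReadout.etaRateIneq342_of_hasMaj_rateWeight`, `T4EtaRateCoeffDefect.fit_blockAvg` BY NAME; nothing in the tree is modified.

WHAT.  §5 `sq_add_two_le`, `levelCount_rate_le` (`(K+2)∕L^K ≤ 2(L^K)^{−1∕2}`, `L ≥ 3`); the index `EtaLatIdx d m₀²` of dag-n15-e's rung (cube `2L^e`, coarse levels `K ≥ 1`, refinement `n ≥ 1`, mass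
`0 < m² ≤ m₀²`, [B9] size datum `M_sz ≥ 1`); `foKingInstance` (II-E's `foInstanceFG` with Bałaban's torus family replaced by the rung's cubes: sized carrier `unitTorusGeoS L K (2L^e) M_sz`, King's
1-form blocks `blkFine`, King's pairing `kingPrV`, background carriers `coeffBgFO` = the (3.35) PAIR «|A|, |∇^ηA|» AND NOTHING ELSE), `foKingInstance_gf_M` (guard LIVE), `foKingInstance_cofinal`
(size AND level count cofinal — not the empty-guard trap); `foKingFamily a ν κ` = II-E's `foOps` at `G := A₀⁻¹ ⊗ 1`, `G′ := A₀′⁻¹ ⊗ 1` with ENTRY 0 = `𝔇(X′(U), X(Ū))` (values of the dressed pair),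
ENTRY 1 = `𝔇(∇′_νX′(U), ∇_νX(Ū))` (THE DRESSED GRADIENT, background LIVE — the component `projO (some ν)` of n15-b's stacked jet), ENTRIES 2–3 = the rung's own `U ≡ 1` η-defects
`𝔇((A₀′⁻¹N′∇′*_κ) ⊗ 1, (A₀⁻¹N∇*_κ) ⊗ 1)`, `𝔇((N′²Δ′A₀′⁻¹) ⊗ 1, (N²ΔA₀⁻¹) ⊗ 1)` (background-BLIND in THIS file: the dressed DIVERGENCE entry is located — it needs the pure second source
difference of `A₀′⁻¹` summed over cells (dag-n15-d g18∕g21); the dressed COVARIANT-Laplacian entry `N²Δ_V X = m²X + T(1 + VX) − 1`, `T = a_KQ*QA₀⁻¹`, is LIVE by dag-n15-d g21's constraint-term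
identity and face lemma (their INTENT-1∕2 `…KingModelConstraintTerm` ∕ `…KingModelConstraintCellOscillation`, INBOX 19:43Z) — the edition with entries 0, 1 AND 3 live is the sequel K-D).
§6 ★★★ `ne2PlusOperator_kingJet_firstOrder (hd : 1 ≤ d) (hLodd) (hL : 2 ≤ L) (ha) (hm0) (c₃₅) (hc₃₅) (ν κ) : NE2PlusOperator c₃₅ (foKingInstance d L) (foKingFamily d L a ν κ)`
— HYPOTHESIS-FREE: `M₅ = 1`, `a₀ = r₀∕c₃₅` (K-B's window at King's `γ = ½`), exponent `¼`, entries 0–1 = K-B ★★ at `j = none ∕ some ν` with the fit of `a′` DERIVED from the carrier's `|∇′a′|` clause (II-E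
`fibreOsc_of_fgrad` + `fit_blockAvg` + `osc_rate_le`) and the level count absorbed by `levelCount_rate_le`; ★★ `ne2ZeroOperator_kingJet_firstOrder`; `_dim4`.

HONEST FRAMING ∕ LIMITS.  HYBRID family: the background is LIVE in entries 0 AND 1 (new: the dressed GRADIENT entry under (3.35)-letters only), entries 2–3 are the rung's `U ≡ 1` η-defects
(flat objects; the covariant entry 3 is dag-n15-d g21's, the sequel K-D);
abelianised scalar-multiplier MODEL of (3.52)'s `V′(A)`, block-averaged coarse partner (C3); King's `A = 0` MODEL on finite tori (template literature [King1986] (2.13)–(2.17) p.653, (4.1)–(4.5)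
p.670), NOT Bałaban's covariant `G(U)` (for the pair of record the ninth row is located (S3)); differs from dag-n15-e Σ-d `ne2PlusOperator_kingFullProp_byParts` (carrier `coeffBgBP` with
fibre-oscillation ∕ shift letters on `c′` = (3.36)-strength, p.396 L22–29) exactly in the carrier and in how entry 1 is dressed.  NE2⁺ as printed NOT PRINTED ∕ NOT proved; no statement of
record touched; N15 NOT discharged; K3⁸ OPEN; counts UNMOVED (typed 28∕28 · discharged 5∕27); one finite torus per index — NOT ℝ⁴ ∕ infinite volume ∕ OS ∕ mass gap ∕ Clay.
-/

noncomputable section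

open scoped BigOperators
open Finset

namespace Summit.QuantumFields.YangMills.BalabanUVNodes.N15.TwoGrid.KingJet

open Literature.MathematicalPhysics.QuantumFieldTheory.Balaban1983to89
open Literature.MathematicalPhysics.QuantumFieldTheory.Balaban1983to89.B11SectG (BlockNorm HasMaj)
open Literature.MathematicalPhysics.QuantumFieldTheory.Balaban1983to89.T4EtaRate (PairedInstance EtaPairing EtaRateIneq342 NE2PlusOperator NE2ZeroOperator ne2Zero_of_ne2Plus)
open Literature.MathematicalPhysics.QuantumFieldTheory.Balaban1983to89.T4EtaRateDefect (idef rateWeight)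
open Literature.MathematicalPhysics.QuantumFieldTheory.Balaban1983to89.T4EtaRateCoeffDefect (pull blockAvg fit_blockAvg)
open Literature.MathematicalPhysics.QuantumFieldTheory.Balaban1983to89.B5Prop11Plancherel (Tor fine unitVec)
open Literature.MathematicalPhysics.QuantumFieldTheory.King1986.Torus (blockOf tdistT tdistT_nonneg)
open Literature.MathematicalPhysics.QuantumFieldTheory.Balaban1983to89.B6UnitTorusCarrier (unitTorusGeo)
open Summit.QuantumFields.YangMills.BalabanUVNodes.N15.VectorPiece (blkFine kingPrV blkFine_comp_kingPrV unitTorusGeoS rateWeight_unitTorusGeoS tensorId bshiftEquiv)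
open Summit.QuantumFields.YangMills.BalabanUVNodes.N15.OperatorReadout (opGeo opFamily opGeo_len etaRateIneq342_of_hasMaj_rateWeight)
open Summit.QuantumFields.YangMills.BalabanUVNodes.N15.BackgroundLayer (bgPair projO fineGeo one_le_pref4 fgrad fgrad_apply fibreOsc_of_fgrad)
open Summit.QuantumFields.YangMills.BalabanUVNodes.N15KingModelRung.Curved (kingGOp kingSOp kingLapOp EtaLatIdx)

variable {d : ℕ}

/-! ## §5 The level count is below the rate; the realised instance family over the rung's index -/

/-- `(K+2)² ≤ 4·3^K`. [folklore] -/
theorem sq_add_two_le (K : ℕ) : (K + 2) ^ 2 ≤ 4 * 3 ^ K := by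
  induction K with
  | zero => norm_num
  | succ K ih =>
    have h3 : (K + 1 + 2) ^ 2 ≤ 3 * (K + 2) ^ 2 := by
      have e : (K + 1 + 2) ^ 2 + (2 * K ^ 2 + 6 * K + 3) = 3 * (K + 2) ^ 2 := by ring
      exact e ▸ Nat.le_add_right _ _
    calc (K + 1 + 2) ^ 2 ≤ 3 * (K + 2) ^ 2 := h3
      _ ≤ 3 * (4 * 3 ^ K) := Nat.mul_le_mul_left 3 ih
      _ = 4 * 3 ^ (K + 1) := by ring

/-- THE LEVEL COUNT IS BELOW THE RATE: `(K+2)∕L^K ≤ 2·(L^K)^{−1∕2}` for `L ≥ 3`. [folklore] -/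
theorem levelCount_rate_le {L : ℕ} (hL : 3 ≤ L) (K : ℕ) : (((K : ℕ) : ℝ) + 2) / (L : ℝ) ^ K ≤ 2 * ((L : ℝ) ^ K) ^ (-(1 / 2 : ℝ)) := by
  have hLr : (0 : ℝ) < (L : ℝ) := by exact_mod_cast (show 0 < L by omega)
  have hX : (0 : ℝ) < (L : ℝ) ^ K := pow_pos hLr K
  have hnat : (K + 2) ^ 2 ≤ 4 * L ^ K := (sq_add_two_le K).trans (Nat.mul_le_mul_left 4 (Nat.pow_le_pow_left hL K))
  have hreal : (((K : ℕ) : ℝ) + 2) ^ 2 ≤ 4 * (L : ℝ) ^ K := by exact_mod_cast hnat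
  set s : ℝ := Real.sqrt ((L : ℝ) ^ K) with hs_def
  have hs0 : 0 < s := Real.sqrt_pos.mpr hX
  have hsX : s ^ 2 = (L : ℝ) ^ K := Real.sq_sqrt hX.le
  have hK2 : ((K : ℕ) : ℝ) + 2 ≤ 2 * s := by nlinarith [hs0, hsX, hreal, Nat.cast_nonneg (α := ℝ) K]
  have hrpow : ((L : ℝ) ^ K) ^ (-(1 / 2 : ℝ)) = s⁻¹ := by
    rw [Real.rpow_neg hX.le, ← Real.sqrt_eq_rpow]
  rw [hrpow, div_le_iff₀ hX, ← hsX]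
  calc ((K : ℕ) : ℝ) + 2 ≤ 2 * s := hK2
    _ = 2 * s⁻¹ * s ^ 2 := by field_simp

section Sized

variable (d) (L : ℕ) [NeZero L] {m0sq : ℝ}

/-- THE REALISED PAIRED INSTANCE at a rung index `i` (cube `2L^e`, runs `K`, `K + n`, mass `m²`, size `M_sz`) over the (3.35)-pair first-order carriers `coeffBgFO` (II-E), King's 1-form blocks and
pairing on the SIZED carrier. [cite: Balaban1985BackgroundPropagators, Thm 3.14 pp.426–427 (typing template), (3.35) p.396; King1986, p.664 (pairing)] -/
def foKingInstance (i : EtaLatIdx d m0sq) : PairedInstance :=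
  ⟨opGeo (unitTorusGeoS L i.K (EtaLatIdx.cube L i) i.Msz) (Tor (fine (L ^ i.K) (EtaLatIdx.cube L i)) × Fin (d + 1)) (blkFine L i.K (EtaLatIdx.cube L i)),
    fineGeo (unitTorusGeoS L i.K (EtaLatIdx.cube L i) i.Msz) (Tor (fine (L ^ i.n * L ^ i.K) (EtaLatIdx.cube L i)) × Fin (d + 1))
      (blkFine L i.K (EtaLatIdx.cube L i) ∘ kingPrV L i.K i.n (EtaLatIdx.cube L i)) i.n,
    coeffBgFO (EtaLatIdx.cube L i) (L ^ i.K) i.Msz, coeffBgFO (EtaLatIdx.cube L i) (L ^ i.n * L ^ i.K) i.Msz,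
    foPairing (EtaLatIdx.cube L i) i.K i.n i.Msz⟩

/-- THE GUARD IS LIVE: `(gf i).M = M_sz`. [folklore] -/
theorem foKingInstance_gf_M (i : EtaLatIdx d m0sq) : (foKingInstance d L i).gf.M = i.Msz := rfl

/-- The coarse realised instance's number of levels IS the index's `K`. [folklore] -/
theorem foKingInstance_gc_k (i : EtaLatIdx d m0sq) : (foKingInstance d L i).gc.k = i.K := rfl

/-- NOT THE EMPTY-GUARD TRAP: size datum AND coarse level count are cofinal over the index family (mass window inhabited). [folklore] -/
theorem foKingInstance_cofinal (hm0 : 0 < m0sq) (M₅ : ℝ) (k₀ : ℕ) : ∃ i : EtaLatIdx d m0sq, M₅ ≤ (foKingInstance d L i).gf.M ∧ k₀ ≤ (foKingInstance d L i).gc.k :=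
  ⟨⟨0, max k₀ 1, le_max_right _ _, 1, le_rfl, m0sq, hm0, le_rfl, max M₅ 1, le_max_right _ _⟩, le_max_left _ _, le_max_left _ _⟩

/-- THE KERNEL FAMILY at a rung index: II-E's `foOps` at `G := A₀⁻¹ ⊗ 1` (coarse run, `K` levels), `G′ := A₀′⁻¹ ⊗ 1` (fine run, `K + n` levels) — entry 0 = values of the first-order dressed pair,
background LIVE — with entry 1 := THE DRESSED GRADIENT `𝔇(∇′_νX′(U), ∇_νX(Ū))` (component `some ν` of n15-b's stacked jet, background LIVE), entries 2–3 := the rung's own `U ≡ 1` η-defects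
`𝔇((A₀′⁻¹N′∇′*_κ) ⊗ 1, (A₀⁻¹N∇*_κ) ⊗ 1)`, `𝔇((N′²Δ′A₀′⁻¹) ⊗ 1, (N²ΔA₀⁻¹) ⊗ 1)` (background-blind here; the covariant-Laplacian edition of entry 3 is the sequel K-D); read through `opFamily`.
[cite: Balaban1985BackgroundPropagators, (3.42) p.397 (the four entries: shape), (3.52) p.400, (3.62)–(3.65) pp.402–403 (mechanism); King1986, (2.13) p.653] -/
def foKingFamily (a : ℝ) (ν κ : Fin (d + 1)) (i : EtaLatIdx d m0sq) : B9.KernelFamily (foKingInstance d L i).gc (foKingInstance d L i).Bf :=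
  show B9.KernelFamily (opGeo (unitTorusGeoS L i.K (EtaLatIdx.cube L i) i.Msz) (Tor (fine (L ^ i.K) (EtaLatIdx.cube L i)) × Fin (d + 1)) (blkFine L i.K (EtaLatIdx.cube L i)))
      (coeffBgFO (EtaLatIdx.cube L i) (L ^ i.n * L ^ i.K) i.Msz) from
    opFamily (g := unitTorusGeoS L i.K (EtaLatIdx.cube L i) i.Msz) (B := coeffBgFO (EtaLatIdx.cube L i) (L ^ i.n * L ^ i.K) i.Msz)
      (blkFine L i.K (EtaLatIdx.cube L i)) (blkFine L i.K (EtaLatIdx.cube L i) ∘ kingPrV L i.K i.n (EtaLatIdx.cube L i))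
      (foOps (EtaLatIdx.cube L i) i.K i.n i.Msz (tensorId (Fin (d + 1)) (kingGOp L a i.msq i.K (L ^ i.K) (EtaLatIdx.cube L i)))
        (tensorId (Fin (d + 1)) (kingGOp L a i.msq (i.K + i.n) (L ^ i.n * L ^ i.K) (EtaLatIdx.cube L i)))
        fun j U => ![
          idef (pull (kingPrV L i.K i.n (EtaLatIdx.cube L i))) (pull (kingPrV L i.K i.n (EtaLatIdx.cube L i)))
            (projO (some ν) ∘ₗ bgPair (tensorId (Fin (d + 1)) (kingGOp L a i.msq (i.K + i.n) (L ^ i.n * L ^ i.K) (EtaLatIdx.cube L i)))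
              (fun μ => symbOp (EtaLatIdx.cube L i) (L ^ i.n * L ^ i.K) (sD (EtaLatIdx.cube L i) (L ^ i.n * L ^ i.K) μ ((L ^ i.n * L ^ i.K : ℕ) : ℝ)) ∘ₗ
                tensorId (Fin (d + 1)) (kingGOp L a i.msq (i.K + i.n) (L ^ i.n * L ^ i.K) (EtaLatIdx.cube L i))) U.1 U.2)
            (projO (some ν) ∘ₗ bgPair (tensorId (Fin (d + 1)) (kingGOp L a i.msq i.K (L ^ i.K) (EtaLatIdx.cube L i)))
              (fun μ => symbOp (EtaLatIdx.cube L i) (L ^ i.K) (sD (EtaLatIdx.cube L i) (L ^ i.K) μ ((L ^ i.K : ℕ) : ℝ)) ∘ₗ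
                tensorId (Fin (d + 1)) (kingGOp L a i.msq i.K (L ^ i.K) (EtaLatIdx.cube L i)))
              (blockAvg (kingPrV L i.K i.n (EtaLatIdx.cube L i)) U.1) (fun μ => blockAvg (kingPrV L i.K i.n (EtaLatIdx.cube L i)) (U.2 μ))),
          idef (pull (kingPrV L i.K i.n (EtaLatIdx.cube L i))) (pull (kingPrV L i.K i.n (EtaLatIdx.cube L i)))
            (tensorId (Fin (d + 1)) (kingSOp L a i.msq (i.K + i.n) (L ^ i.n * L ^ i.K) (EtaLatIdx.cube L i) κ))
            (tensorId (Fin (d + 1)) (kingSOp L a i.msq i.K (L ^ i.K) (EtaLatIdx.cube L i) κ)),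
          idef (pull (kingPrV L i.K i.n (EtaLatIdx.cube L i))) (pull (kingPrV L i.K i.n (EtaLatIdx.cube L i)))
            (tensorId (Fin (d + 1)) (kingLapOp L a i.msq (i.K + i.n) (L ^ i.n * L ^ i.K) (EtaLatIdx.cube L i)))
            (tensorId (Fin (d + 1)) (kingLapOp L a i.msq i.K (L ^ i.K) (EtaLatIdx.cube L i)))] j)

end Sized

/-! ## §6 ★★★ `NE2PlusOperator` BY NAME, entries 0 and 1 background-live, hypothesis-free -/

section Main

variable (d) {L : ℕ} [NeZero L] {m0sq : ℝ}

/-- ★★★ **NE2⁺, OPERATOR LAYER — `T4EtaRate.NE2PlusOperator` BY NAME, HYPOTHESIS-FREE, FOR KING's FULL `A = 0` PROPAGATOR `⊗ 1` DRESSED BY THE FIRST-ORDER SPECIES ON THE (3.35)-PAIR CARRIER, WITH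
THE VALUE AND THE GRADIENT ENTRIES BACKGROUND-LIVE.**  For `d ≥ 1`, odd `L ≥ 3` (stated `Odd L`, `2 ≤ L`), `a > 0`, `m₀² ≥ 0`, `c₃₅ > 0`, directions `ν, κ`:
`NE2PlusOperator c₃₅ (foKingInstance d L) (foKingFamily d L a ν κ)`.  (3.35) is consumed as the sup of `c′`, `a′_μ` and of the first quotients of `a′` — NOTHING on `∇c′`; the size guard is LIVE
(cofinal family); `M_sz·α₀ ≤ a₀ = r₀∕c₃₅` drives the jets' Neumann series; entries 0 AND 1 carry the background GENUINELY (K-B); entries 2–3 are the rung's `U ≡ 1` η-defects (K-A); King's exponent taken at `γ = ½`,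
common rate number `(L^K)^{−1∕4}` (the level count `(K+2)L^{−K}` and the derived fit `L^{−K}` absorbed). [cite: Balaban1985BackgroundPropagators, Thm 3.1 p.397 (quantifier template), (3.35) p.396, (3.42) p.397, (3.52)
p.400, (3.62)–(3.65) pp.402–403 (shapes, mechanism); King1986, (2.13)–(2.17) p.653, Prop. 3.8 (3.71) p.664, Prop. 3.9 (3.73) p.665, (4.42) p.675] -/
theorem ne2PlusOperator_kingJet_firstOrder (hd : 1 ≤ d) (hLodd : Odd L) (hL : 2 ≤ L) {a : ℝ} (ha : 0 < a) (hm0 : 0 ≤ m0sq) (c35 : ℝ) (hc35 : 0 < c35)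
    (ν κ : Fin (d + 1)) : NE2PlusOperator c35 (foKingInstance d L (m0sq := m0sq)) (foKingFamily d L a ν κ) := by
  -- King's rate exponent `γ := 1∕2` (any `γ ∈ (0, 1)` would do); the family's rate number is then `(L^K)^{−1∕4}`
  obtain ⟨γ, hγ0, hγ1⟩ : ∃ γ : ℝ, 0 < γ ∧ γ < 1 := ⟨1 / 2, by norm_num, by norm_num⟩
  have hL3 : 3 ≤ L := by
    rcases hLodd with ⟨t, ht⟩
    omega
  have hL1 : (1 : ℝ) ≤ (L : ℝ) := by exact_mod_cast (show 1 ≤ L by omega)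
  have hLr : (0 : ℝ) < (L : ℝ) := by positivity
  -- entries 0–1: K-B; entries 2–3: K-A
  obtain ⟨δJ, r₀, B, hδJ, hr₀, hB, HJ⟩ := hasMaj_projO_idef_bgPair_kingJet d L hd hLodd hL ha hm0 hγ0.le hγ1
  obtain ⟨m₂, δ₂, hm₂, hδ₂, H2⟩ := hasMaj_idef_tensorId_kingSOp (d := d) L hLodd hL ha hm0 hγ0.le hγ1
  obtain ⟨m₃, δ₃, hm₃, hδ₃, H3⟩ := hasMaj_idef_tensorId_kingLapOp (d := d) L hLodd hL ha hm0 hγ0.le hγ1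
  set δ₀ : ℝ := min δJ (min δ₂ δ₃) with hδ₀def
  have hδ₀ : 0 < δ₀ := lt_min hδJ (lt_min hδ₂ hδ₃)
  set BJ : ℝ := B * (1 + 2 * r₀ + 2 * ((d : ℝ) + 1) * r₀) with hBJdef
  have hBJ : 0 < BJ := by positivity
  set B₀ : ℝ := BJ + m₂ + m₃ with hB₀def
  have hB₀ : 0 < B₀ := by positivity
  refine ⟨1, δ₀, r₀ / c35, B₀, γ / 2, one_pos, hδ₀, by positivity, hB₀, by positivity, fun i _hM α₀ hα₀ hMα U hU => ?_⟩
  -- at the index `i`: the letters of the configuration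
  obtain ⟨hU1, hU2, hU3⟩ := (reg335_coeffBgFO_iff (EtaLatIdx.cube L i) (L ^ i.n * L ^ i.K) i.Msz c35 α₀ U).1 hU
  have hMsz : (0 : ℝ) ≤ i.Msz := zero_le_one.trans i.one_le_Msz
  have hr0 : 0 ≤ c35 * i.Msz * α₀ := by positivity
  have hrr₀ : c35 * i.Msz * α₀ ≤ r₀ := by
    have h := mul_le_mul_of_nonneg_left hMα hc35.le
    rw [foKingInstance_gf_M, mul_div_cancel₀ _ hc35.ne'] at h
    linarith [h]
  have hn' : (0 : ℝ) < ((L ^ i.n * L ^ i.K : ℕ) : ℝ) := by positivity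
  have hfa : ∀ μ' z, |U.2 μ' z - blockAvg (kingPrV L i.K i.n (EtaLatIdx.cube L i)) (U.2 μ') (kingPrV L i.K i.n (EtaLatIdx.cube L i) z)| ≤
      ((2 * ((d + 1) * (L ^ i.n - 1)) : ℕ) : ℝ) * (c35 * i.Msz * α₀ / ((L ^ i.n * L ^ i.K : ℕ) : ℝ)) :=
    fun μ' z => fit_blockAvg _ (fibreOsc_of_fgrad L i.K i.n (EtaLatIdx.cube L i) hn' fun κ' z => hU3 μ' κ' z) z
  have hoa : 0 ≤ ((2 * ((d + 1) * (L ^ i.n - 1)) : ℕ) : ℝ) * (c35 * i.Msz * α₀ / ((L ^ i.n * L ^ i.K : ℕ) : ℝ)) := by positivity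
  have hJ := HJ i.K i.one_le_K i.n i.one_le_n i.e (EtaLatIdx.cube L i) (fun _ => rfl) i.msq i.msq_pos i.msq_le _ hr0 hrr₀ _ hoa U.1 U.2 hU1 hU2 hfa
  -- the readout
  have hη : 0 < (unitTorusGeoS L i.K (EtaLatIdx.cube L i) i.Msz).eta := inv_pos.mpr (pow_pos hLr _)
  have hblk : blkFine L i.K (EtaLatIdx.cube L i) ∘ kingPrV L i.K i.n (EtaLatIdx.cube L i) =
      fun j : Tor (fine (L ^ i.n * L ^ i.K) (EtaLatIdx.cube L i)) × Fin (d + 1) => blockOf (L ^ i.n * L ^ i.K) (EtaLatIdx.cube L i) j.1 :=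
    blkFine_comp_kingPrV (EtaLatIdx.cube L i) L i.K i.n
  unfold foKingFamily
  rw [hblk]
  -- the common rate number and the three absorptions
  have hθ : 0 ≤ ((L : ℝ) ^ i.K) ^ (-(γ / 2)) := Real.rpow_nonneg (pow_nonneg hLr.le _) _
  have hx1 : (1 : ℝ) ≤ (L : ℝ) ^ i.K := one_le_pow₀ hL1
  have hhalf : ((L : ℝ) ^ i.K) ^ (-(1 / 2 : ℝ)) ≤ ((L : ℝ) ^ i.K) ^ (-(γ / 2)) := Real.rpow_le_rpow_of_exponent_le hx1 (by linarith)
  have hlev : (c35 * i.Msz * α₀) * ((((i.K : ℕ) : ℝ) + 2) / (L : ℝ) ^ i.K) ≤ 2 * r₀ * ((L : ℝ) ^ i.K) ^ (-(γ / 2)) := by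
    calc (c35 * i.Msz * α₀) * ((((i.K : ℕ) : ℝ) + 2) / (L : ℝ) ^ i.K) ≤ r₀ * (2 * ((L : ℝ) ^ i.K) ^ (-(1 / 2 : ℝ))) :=
          mul_le_mul hrr₀ (levelCount_rate_le hL3 i.K) (div_nonneg (by positivity) (pow_nonneg hLr.le _)) hr₀.le
      _ ≤ r₀ * (2 * ((L : ℝ) ^ i.K) ^ (-(γ / 2))) := mul_le_mul_of_nonneg_left (by linarith) hr₀.le
      _ = 2 * r₀ * ((L : ℝ) ^ i.K) ^ (-(γ / 2)) := by ring
  have hosc := osc_rate_le (d := d) i.K i.n hL1 (γ := γ / 2) hr0 hrr₀ (by linarith)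
  have hsum : ((L : ℝ) ^ i.K) ^ (-(γ / 2)) + (c35 * i.Msz * α₀) * ((((i.K : ℕ) : ℝ) + 2) / (L : ℝ) ^ i.K) +
      ((2 * ((d + 1) * (L ^ i.n - 1)) : ℕ) : ℝ) * (c35 * i.Msz * α₀ / ((L ^ i.n * L ^ i.K : ℕ) : ℝ)) ≤ (1 + 2 * r₀ + 2 * ((d : ℝ) + 1) * r₀) * ((L : ℝ) ^ i.K) ^ (-(γ / 2)) := by
    nlinarith [hlev, hosc]
  have hrw : ∀ y' : Tor (EtaLatIdx.cube L i), rateWeight (unitTorusGeoS L i.K (EtaLatIdx.cube L i) i.Msz) (γ / 2) y' = ((L : ℝ) ^ i.K) ^ (-(γ / 2)) :=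
    fun y' => rateWeight_unitTorusGeoS L (EtaLatIdx.cube L i) i.K i.Msz (γ / 2) y'
  have hexp : ∀ {t : ℝ} (y y' : Tor (EtaLatIdx.cube L i)), δ₀ ≤ t →
      Real.exp (-(t * tdistT (EtaLatIdx.cube L i) y y')) ≤ Real.exp (-(δ₀ * tdistT (EtaLatIdx.cube L i) y y')) :=
    fun y y' ht => Real.exp_le_exp.mpr (by nlinarith [tdistT_nonneg (EtaLatIdx.cube L i) y y'])
  have hδ₀J : δ₀ ≤ δJ := min_le_left _ _
  have hδ₀2 : δ₀ ≤ δ₂ := (min_le_right _ _).trans (min_le_left _ _)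
  have hδ₀3 : δ₀ ≤ δ₃ := (min_le_right _ _).trans (min_le_right _ _)
  -- the jet entries' common bound
  have hjet : ∀ j : Option (Fin (d + 1)), HasMaj (BlockNorm.ofBlocks (unitTorusGeoS L i.K (EtaLatIdx.cube L i) i.Msz) (blkFine L i.K (EtaLatIdx.cube L i)))
      (BlockNorm.ofBlocks (unitTorusGeoS L i.K (EtaLatIdx.cube L i) i.Msz) (fun j' : Tor (fine (L ^ i.n * L ^ i.K) (EtaLatIdx.cube L i)) × Fin (d + 1) => blockOf (L ^ i.n * L ^ i.K) (EtaLatIdx.cube L i) j'.1))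
      (idef (pull (kingPrV L i.K i.n (EtaLatIdx.cube L i))) (pull (kingPrV L i.K i.n (EtaLatIdx.cube L i)))
        (projO j ∘ₗ bgPair (tensorId (Fin (d + 1)) (kingGOp L a i.msq (i.K + i.n) (L ^ i.n * L ^ i.K) (EtaLatIdx.cube L i)))
          (fun μ => symbOp (EtaLatIdx.cube L i) (L ^ i.n * L ^ i.K) (sD (EtaLatIdx.cube L i) (L ^ i.n * L ^ i.K) μ ((L ^ i.n * L ^ i.K : ℕ) : ℝ)) ∘ₗ
            tensorId (Fin (d + 1)) (kingGOp L a i.msq (i.K + i.n) (L ^ i.n * L ^ i.K) (EtaLatIdx.cube L i))) U.1 U.2)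
        (projO j ∘ₗ bgPair (tensorId (Fin (d + 1)) (kingGOp L a i.msq i.K (L ^ i.K) (EtaLatIdx.cube L i)))
          (fun μ => symbOp (EtaLatIdx.cube L i) (L ^ i.K) (sD (EtaLatIdx.cube L i) (L ^ i.K) μ ((L ^ i.K : ℕ) : ℝ)) ∘ₗ
            tensorId (Fin (d + 1)) (kingGOp L a i.msq i.K (L ^ i.K) (EtaLatIdx.cube L i)))
          (blockAvg (kingPrV L i.K i.n (EtaLatIdx.cube L i)) U.1) (fun μ => blockAvg (kingPrV L i.K i.n (EtaLatIdx.cube L i)) (U.2 μ))))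
      (fun y y' => BJ * Real.exp (-(δ₀ * tdistT (EtaLatIdx.cube L i) y y')) * rateWeight (unitTorusGeoS L i.K (EtaLatIdx.cube L i) i.Msz) (γ / 2) y') := fun j => by
    refine (hJ j).mono fun y y' => ?_
    rw [hrw]
    have hE := Real.exp_nonneg (-(δJ * tdistT (EtaLatIdx.cube L i) y y'))
    calc B * (((L : ℝ) ^ i.K) ^ (-(γ / 2)) + c35 * i.Msz * α₀ * ((((i.K : ℕ) : ℝ) + 2) / (L : ℝ) ^ i.K) +
            ((2 * ((d + 1) * (L ^ i.n - 1)) : ℕ) : ℝ) * (c35 * i.Msz * α₀ / ((L ^ i.n * L ^ i.K : ℕ) : ℝ))) * Real.exp (-(δJ * tdistT (EtaLatIdx.cube L i) y y'))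
        ≤ B * ((1 + 2 * r₀ + 2 * ((d : ℝ) + 1) * r₀) * ((L : ℝ) ^ i.K) ^ (-(γ / 2))) * Real.exp (-(δ₀ * tdistT (EtaLatIdx.cube L i) y y')) :=
          mul_le_mul (mul_le_mul_of_nonneg_left hsum hB.le) (hexp y y' hδ₀J) hE (by positivity)
      _ = BJ * Real.exp (-(δ₀ * tdistT (EtaLatIdx.cube L i) y y')) * ((L : ℝ) ^ i.K) ^ (-(γ / 2)) := by rw [hBJdef]; ring
  refine etaRateIneq342_of_hasMaj_rateWeight (g := unitTorusGeoS L i.K (EtaLatIdx.cube L i) i.Msz) (B := coeffBgFO (EtaLatIdx.cube L i) (L ^ i.n * L ^ i.K) i.Msz)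
    (blkFine L i.K (EtaLatIdx.cube L i)) (fun j : Tor (fine (L ^ i.n * L ^ i.K) (EtaLatIdx.cube L i)) × Fin (d + 1) => blockOf (L ^ i.n * L ^ i.K) (EtaLatIdx.cube L i) j.1)
    hη hLr hB₀.le (c := ![BJ, BJ, m₂, m₃]) (fun n => by fin_cases n <;> simp <;> positivity) (fun n y => ?_) _ U fun n => ?_
  · -- `c n ≤ B₀ ≤ B₀·pref4`
    have hlen : 1 ≤ (unitTorusGeoS L i.K (EtaLatIdx.cube L i) i.Msz).len y := by
      show (1 : ℝ) ≤ (L : ℝ) ^ i.K * (((L : ℝ) ^ i.K)⁻¹)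
      rw [mul_inv_cancel₀ (pow_ne_zero _ hLr.ne')]
    have hpref := one_le_pref4 hlen n
    have hcn : (![BJ, BJ, m₂, m₃] : Fin 4 → ℝ) n ≤ B₀ := by
      fin_cases n
      · show BJ ≤ B₀; rw [hB₀def]; linarith
      · show BJ ≤ B₀; rw [hB₀def]; linarith
      · show m₂ ≤ B₀; rw [hB₀def]; linarith
      · show m₃ ≤ B₀; rw [hB₀def]; linarith
    calc _ ≤ B₀ := hcn
      _ = B₀ * 1 := (mul_one _).symm
      _ ≤ _ := mul_le_mul_of_nonneg_left hpref hB₀.le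
  · fin_cases n
    · exact hjet none
    · exact hjet (some ν)
    · have h2 := H2 i.K i.one_le_K i.n i.one_le_n i.e (EtaLatIdx.cube L i) (fun _ => rfl) i.msq i.msq_pos i.msq_le κ
      refine h2.mono fun y y' => ?_
      show _ ≤ m₂ * Real.exp (-(δ₀ * tdistT (EtaLatIdx.cube L i) y y')) * rateWeight (unitTorusGeoS L i.K (EtaLatIdx.cube L i) i.Msz) (γ / 2) y'
      rw [hrw]
      calc m₂ * ((L : ℝ) ^ i.K) ^ (-(γ / 2)) * Real.exp (-(δ₂ * tdistT (EtaLatIdx.cube L i) y y'))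
          ≤ m₂ * ((L : ℝ) ^ i.K) ^ (-(γ / 2)) * Real.exp (-(δ₀ * tdistT (EtaLatIdx.cube L i) y y')) := mul_le_mul_of_nonneg_left (hexp y y' hδ₀2) (mul_nonneg hm₂.le hθ)
        _ = _ := by ring
    · have h3 := H3 i.K i.one_le_K i.n i.one_le_n i.e (EtaLatIdx.cube L i) (fun _ => rfl) i.msq i.msq_pos i.msq_le
      refine h3.mono fun y y' => ?_
      show _ ≤ m₃ * Real.exp (-(δ₀ * tdistT (EtaLatIdx.cube L i) y y')) * rateWeight (unitTorusGeoS L i.K (EtaLatIdx.cube L i) i.Msz) (γ / 2) y'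
      rw [hrw]
      calc m₃ * ((L : ℝ) ^ i.K) ^ (-(γ / 2)) * Real.exp (-(δ₃ * tdistT (EtaLatIdx.cube L i) y y'))
          ≤ m₃ * ((L : ℝ) ^ i.K) ^ (-(γ / 2)) * Real.exp (-(δ₀ * tdistT (EtaLatIdx.cube L i) y y')) := mul_le_mul_of_nonneg_left (hexp y y' hδ₀3) (mul_nonneg hm₃.le hθ)
        _ = _ := by ring

/-- ★★ **NE2⁰ FOR THE SAME FAMILY — `T4EtaRate.NE2ZeroOperator` BY NAME**: the trivial family `U = 0` is regular for every `α₀ > 0` under the guard, so `ne2Zero_of_ne2Plus` applies.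
[cite: King1986, Props. 3.8–3.9 (3.71)–(3.75) pp.664–665 (A = 0 model); Balaban1985BackgroundPropagators, Thm 3.1 p.397 (quantifier template)] -/
theorem ne2ZeroOperator_kingJet_firstOrder (hd : 1 ≤ d) (hLodd : Odd L) (hL : 2 ≤ L) {a : ℝ} (ha : 0 < a) (hm0 : 0 ≤ m0sq) {c35 : ℝ} (hc35 : 0 < c35) (ν κ : Fin (d + 1)) :
    NE2ZeroOperator (foKingInstance d L (m0sq := m0sq)) (foKingFamily d L a ν κ) := by
  refine ne2Zero_of_ne2Plus (c35 := c35) (fun i α₀ hα₀ => ?_) (ne2PlusOperator_kingJet_firstOrder d hd hLodd hL ha hm0 c35 hc35 ν κ)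
  have hM : (0 : ℝ) ≤ i.Msz := zero_le_one.trans i.one_le_Msz
  have h0 : (0 : ℝ) ≤ c35 * i.Msz * α₀ := by positivity
  refine (reg335_coeffBgFO_iff (EtaLatIdx.cube L i) (L ^ i.n * L ^ i.K) i.Msz c35 α₀ _).2 ⟨fun z => ?_, fun μ' z => ?_, fun μ' κ' z => ?_⟩
  · show |(0 : ℝ)| ≤ _; rw [abs_zero]; exact h0
  · show |(0 : ℝ)| ≤ _; rw [abs_zero]; exact h0
  · rw [fgrad_apply]
    show |((L ^ i.n * L ^ i.K : ℕ) : ℝ) * ((0 : ℝ) - 0)| ≤ _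
    rw [sub_zero, mul_zero, abs_zero]; exact h0

/-- `d + 1 = 4`: the physical lattice dimension (King's model on `𝕋⁴_ε`; [B9]'s `d = 4`). [cite: King1986, p.653 (d + 1 = 4); Balaban1985BackgroundPropagators, Thm 3.1 p.397] -/
theorem ne2PlusOperator_kingJet_firstOrder_dim4 (hLodd : Odd L) (hL : 2 ≤ L) {a : ℝ} (ha : 0 < a) (hm0 : 0 ≤ m0sq) (c35 : ℝ) (hc35 : 0 < c35) (ν κ : Fin (3 + 1)) :
    NE2PlusOperator c35 (foKingInstance 3 L (m0sq := m0sq)) (foKingFamily 3 L a ν κ) :=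
  ne2PlusOperator_kingJet_firstOrder 3 (by norm_num) hLodd hL ha hm0 c35 hc35 ν κ

end Main

end Summit.QuantumFields.YangMills.BalabanUVNodes.N15.TwoGrid.KingJet

end
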